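/-
Copyright (c) 2026 the pub-hodgecm-mathlib formalisation cell (harness21).  Prover seat hodgecm-mathlib-F0P3a-p01 (g23), 2026-09-03.  E1 row 48 «(SS-O) ELLIPTIC UNFOLDING ASSEMBLY»,
FILE 2 (E1 keeper ∕ dealer F0P3a-p03 (g29) 02:26:58Z ∕ 02:31:24Z; census `F0/P3a/F0P3a-p01/g23/r48/CENSUS-R48-SSO-elliptic-unfolding.v1.F0P3ap01g23.md`).
-/
import Literature.NumberTheory.Automorphic.SmoothCharacterEPFunctionOrbital        -- ★ FILE 1 (this seat) p853322: `kType_conj_apply_eq_levelTrace_inv`, `continuous_of_kType`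
import Literature.NumberTheory.Automorphic.SmoothCharacterEPFunctionValue          -- ★ row 42 VALUE: `support_kType_subset`, `kType_apply_conj`
import Literature.NumberTheory.Automorphic.OrbitalIntegralFixedPointWeightedAction -- ★ (W′2): `classOrbitalIntegral_eq_smul_finsum_fixedPoints_of_vertexAction`
import Literature.MeasureTheory.Group.ConjClassClosedEmbedding              -- ★ `orbitalIntegral_add_of_isClosed` (closed class ⇒ `C_c` additivity)
import Literature.NumberTheory.Automorphic.OrbitalMeasureCanonicalAtPoint        -- ★ D-S1g `IsCanonical.classOrbitalIntegral_mk_eq_orbitalIntegral'`, `compactCore_eq_univ`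
import Literature.NumberTheory.Automorphic.ClosedCompactDecomposition            -- ★ `isInvInvariant_of_compactSpace`
import HarnessLib

/-!
# The orbital integral of an Euler–Poincaré sum of `K`-type functions `𝟙_P · χ_τ(·⁻¹)` on an elliptic class, unfolded over the fixed points of the facet orbits:
# `Φ(γ, Σ_i (−1)^{d_i} (ν P_i)⁻¹ 𝟙_{P_i} χ_{τ_i}(·⁻¹)) = Σ_i (−1)^{d_i} Σ_{x ∈ Fix_{W_i}(γ)} Θ_{U_x}(γ⁻¹)` (Schneider–Stuhler 1997 §III.4; Kottwitz 1988 §2)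

Topic `NumberTheory/Automorphic`; namespace `Literature.NumberTheory.Automorphic` (that of ★ `OrbitalIntegralFixedPointWeightedAction`).  THEOREMS ONLY (no definition, no
instance, no notation, no named fact, no `sorry`).  Cell `pub/hodgecm-mathlib` (D-0151), crux H413 = `stmt-HodgeConjecture-24833`; E1 row 48 FILE 2: the PER-ORBIT elliptic term
of the (SS-O) unfolding — ★ (W′2) `classOrbitalIntegral_eq_smul_finsum_fixedPoints_of_vertexAction` fed with ★ FILE 1's value law `kType_conj_apply_eq_levelTrace_inv` and
continuity `continuous_of_kType` and ★ row-42 VALUE's support ∕ conjugation-invariance of `f = 𝟙_P · χ_τ(·⁻¹)`.  The facet orbit is an ABSTRACT transitive `G`-set `W`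
(a vertex type of the tree, or the FLAGS `(x, y)` for the edge orbit of a bipartite tree — the ★ edge reading of (W′2) assumes one DART orbit and is not used here).
HONEST LABEL: count-neutral generic base layer ((R-SS) not chartered; E1 = PRINT until the charter test); HC_CM is proved only modulo the 2 remaining named inputs
(hLiu418 24832, h413 24833) until rung 0 closes; nothing printed is asserted here.

* §0 (pure bookkeeping) `finsum_mem_setOf_eq_sum_filter_of_subset` (JUNCTION `∑ᶠ x ∈ {x | p x}` ↔ `∑ x ∈ hS.toFinset with p x`, the currency of ★ 41f B2) and
  `sum_finsum_mem_fiber_eq_finsum_mem` (REGROUPING the orbit-by-orbit sums over the fibres of a type map into one fixed-point sum).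
* §1 **`classOrbitalIntegral_kType_eq_smul_finsum_levelTrace`** (one orbit, mass `ν.real P` carried) and **`classOrbitalIntegral_invMeasure_smul_kType_eq_finsum_levelTrace`**
  (the EP normalisation `(ν.real P)⁻¹ • f`: the volume cancels).
* §2 `classOrbitalIntegral_finset_sum_smul_of_isClosed` — generic ADDITIVITY (A1) of the elliptic class orbital integral over `∑ i ∈ s, c i • f i`, `f i ∈ C_c(G)`.
* §3 **`classOrbitalIntegral_epSum_kType_eq_sum_finsum_levelTrace`** — THE HEAD over a finite family of facet orbits `W i` with signs `(−1)^{d i}`.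
* §4 `classOrbitalIntegral_epSum_kType_eq_sum_sum_filter_levelTrace` — the head in the `Finset` currency (§0 junction, `S i ⊇ Fix_{W i}(γ)` finite).

## References
* [SchneiderStuhler1997] P. Schneider, U. Stuhler, *Representation theory and sheaves on the Bruhat–Tits building*, Publ. Math. IHÉS 85 (1997), §III.4.
* [Kottwitz1988] R. E. Kottwitz, *Tamagawa numbers*, Ann. of Math. 127 (1988), §2.
* [Rogawski1990] J. D. Rogawski, *Automorphic Representations of Unitary Groups in Three Variables*, Ann. of Math. Stud. 123 (1990), §4.9 p. 54.
-/

set_option autoImplicit false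

noncomputable section

open MeasureTheory Measure Function
open Literature.MeasureTheory.Group
open scoped ENNReal NNReal Pointwise

namespace Literature.NumberTheory.Automorphic

/-! ## §0 Junction lemma (`finsum` over a set-builder set ↔ filtered `Finset` sum; pure) -/

/-- **JUNCTION (`finsum` ↔ filtered `Finset` sum)**: if `{x | p x}` lies in a finite set `S`, then `Σᶠ_{x ∈ {x | p x}} F x = Σ_{x ∈ S with p x} F x` — the one `rw` between the
`finsum` currency of §1–§3 below (what ★ (W′2) returns, `p x := act γ x = x`) and the `∑ x ∈ hS.toFinset with act γ x = x` currency of the character side (★ 41f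
`Representation.levelTrace_eq_fixedVertexSum_sub_fixedEdgeSum_of_blockTraces`); the bookkeeping step «sum over the fixed facets» of the cited computation.
[cite: SchneiderStuhler1997, §III.4] [cite: Kottwitz1988, §2] -/
theorem finsum_mem_setOf_eq_sum_filter_of_subset {W : Type*} (p : W → Prop) {S : Set W} (hS : S.Finite) (hpS : ∀ x : W, p x → x ∈ S)
    {M : Type*} [AddCommMonoid M] (F : W → M) [DecidablePred p] :
    ∑ᶠ x ∈ {x : W | p x}, F x = ∑ x ∈ hS.toFinset with p x, F x := by
  have hset : {x : W | p x} = ↑(hS.toFinset.filter p) := by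
    ext x
    simp only [Set.mem_setOf_eq, Finset.coe_filter, Set.Finite.mem_toFinset]
    exact ⟨fun h => ⟨hpS x h, h⟩, fun h => h.2⟩
  rw [hset, finsum_mem_coe_finset]

/-- **REGROUPING ORBIT SUMS (generic (A4), pure)**: for a type map `t : W → ι`, a finite index set `s` and a predicate `p` with `{x | p x}` finite,
`Σ_{i ∈ s} Σᶠ_{x : {x // t x = i}, p x} F x = Σᶠ_{x ∈ {x | p x ∧ t x ∈ s}} F x` — the orbit-by-orbit right-hand side of §3 (each orbit `W i` realised as the fibre
`{x // t x = i}` of a `G`-invariant type map) summed back into ONE fixed-point sum over the ambient `G`-set; the bookkeeping step «facets = ⊔ orbits» of the cited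
computation. [cite: SchneiderStuhler1997, §III.4] [cite: Kottwitz1988, §2] -/
theorem sum_finsum_mem_fiber_eq_finsum_mem {W ι : Type*} (t : W → ι) (s : Finset ι) (p : W → Prop) (hp : {x : W | p x}.Finite)
    {M : Type*} [AddCommMonoid M] (F : W → M) :
    ∑ i ∈ s, ∑ᶠ x ∈ {x : {x : W // t x = i} | p x.1}, F x.1 = ∑ᶠ x ∈ {x : W | p x ∧ t x ∈ s}, F x := by
  classical
  have hfib : ∀ i : ι, ∑ᶠ x ∈ {x : {x : W // t x = i} | p x.1}, F x.1 = ∑ᶠ x ∈ {x : W | p x ∧ t x = i}, F x := by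
    intro i
    apply finsum_mem_eq_of_bijOn Subtype.val ?_ fun _ _ => rfl
    exact ⟨fun x hx => ⟨hx, x.2⟩, Subtype.val_injective.injOn, fun y hy => ⟨⟨y, hy.2⟩, hy.1, rfl⟩⟩
  simp only [hfib]
  have hU : {x : W | p x ∧ t x ∈ s} = ⋃ i ∈ (s : Set ι), {x : W | p x ∧ t x = i} := by
    ext x
    simp only [Set.mem_setOf_eq, Set.mem_iUnion, Finset.mem_coe, exists_prop]
    exact ⟨fun h => ⟨t x, h.2, h.1, rfl⟩, fun ⟨i, hi, hpx, hti⟩ => ⟨hpx, by rw [hti]; exact hi⟩⟩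
  rw [hU, finsum_mem_biUnion _ s.finite_toSet fun i _ => hp.subset fun x hx => hx.1, finsum_mem_coe_finset]
  intro i _ j _ hij
  exact Set.disjoint_left.2 fun x hxi hxj => hij (hxi.2.symm.trans hxj.2)

variable {G : Type*} [Group G] [TopologicalSpace G] [IsTopologicalGroup G] [LocallyCompactSpace G]
  [SecondCountableTopology G] [T2Space G] [MeasurableSpace G] [BorelSpace G]
  [∀ γ : G, MeasurableSpace (G ⧸ Subgroup.centralizer ({γ} : Set G))]
  [∀ γ : G, BorelSpace (G ⧸ Subgroup.centralizer ({γ} : Set G))]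
  {V : Type*} [AddCommGroup V] [Module ℂ V] (ρ : Representation ℂ G V)

section OneOrbit

variable {W : Type*} (act : G → W → W) (act_one : ∀ x : W, act 1 x = x) (act_mul : ∀ (g h : G) (x : W), act (g * h) x = act g (act h x))

/-! ## §1 One facet orbit -/

include act_one act_mul in
/-- **THE ELLIPTIC ORBITAL INTEGRAL OF ONE `K`-TYPE FUNCTION, UNFOLDED OVER THE FIXED POINTS OF ITS FACET ORBIT**: `W` a transitive `G`-set with base point `x₀`,
`P = Stab(x₀)` compact open, `U : W → Subgroup G` a level family (compact open, `U (g·x) = g (U x) g⁻¹`, `U x₀ ≤ P ≤ N(U x₀)`), `τ` the restriction of `ρ` to `P` on `V^{U x₀}`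
(trivial on `U x₀`), `f = 𝟙_P · χ_τ(·⁻¹)` (★ row 42 letters); `m` canonical for `(Q, ν)`, `Q γ`, `C_G(γ)` compact, the class of `γ` closed.  Then
`classOrbitalIntegral m f ⟦γ⟧ = ν(P) · Σᶠ_{x ∈ Fix_W(γ)} Θ_{U x}(γ⁻¹)`. [cite: SchneiderStuhler1997, §III.4] [cite: Kottwitz1988, §2] [cite: Rogawski1990, §4.9 p. 54] -/
theorem classOrbitalIntegral_kType_eq_smul_finsum_levelTrace {Q : G → Prop} (hQ : ∀ g x : G, Q g → Q (x * g * x⁻¹))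
    {ν : Measure G} [ν.IsHaarMeasure] [ν.IsMulRightInvariant] {m : OrbitalMeasureFamily G} (hm : m.IsCanonical Q ν)
    {γ : G} (hγ : Q γ) [CompactSpace (Subgroup.centralizer ({γ} : Set G))] (hO : IsClosed {g : G | ∃ y : G, y * γ * y⁻¹ = g})
    {x₀ : W} (hV : ∀ x : W, ∃ g : G, act g x₀ = x) (P : Subgroup G) (hP : ∀ g : G, g ∈ P ↔ act g x₀ = x₀)
    (hPo : IsOpen (P : Set G)) (hPc : IsCompact (P : Set G))
    (U : W → Subgroup G) (hUo : ∀ x, IsOpen (U x : Set G)) (hUc : ∀ x, IsCompact (U x : Set G))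
    (hUg : ∀ (g : G) (x : W), U (act g x) = (U x).map (MulAut.conj g).toMonoidHom) (hUP : U x₀ ≤ P) (hPU : P ≤ Subgroup.normalizer (U x₀ : Set G))
    (τ : Representation ℂ ↥P ↥(ρ.fixedPoints (U x₀))) (hτρ : ∀ (p : ↥P) (w : ↥(ρ.fixedPoints (U x₀))), ((τ p w : ↥(ρ.fixedPoints (U x₀))) : V) = ρ (p : G) (w : V))
    (hτ : ∀ (u : G) (hu : u ∈ U x₀), τ ⟨u, hUP hu⟩ = 1) [FiniteDimensional ℂ ↥(ρ.fixedPoints (U x₀))]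
    {f : G → ℂ} (hfP : ∀ (g : G) (hg : g ∈ P), f g = Representation.character τ ⟨g, hg⟩⁻¹) (hf0 : ∀ g ∉ P, f g = 0) :
    classOrbitalIntegral m f (ConjClasses.mk γ) = ν.real (P : Set G) • ∑ᶠ x ∈ {x : W | act γ x = x}, ρ.levelTrace (hUo x) (hUc x) γ⁻¹ :=
  classOrbitalIntegral_eq_smul_finsum_fixedPoints_of_vertexAction act act_one act_mul hQ hm hγ hV P hP hPo hPc hO f
    (Representation.continuous_of_kType (hUo x₀) hUP τ hτ hfP hf0) (Representation.support_kType_subset hf0)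
    (fun _ hk y => Representation.kType_apply_conj τ hfP hf0 hk y)
    (fun x => ρ.levelTrace (hUo x) (hUc x) γ⁻¹)
    (fun _ hg => ρ.kType_conj_apply_eq_levelTrace_inv act act_one act_mul x₀ U hUo hUc hUg hP hPU τ hτρ hfP hg)

include act_one act_mul in
/-- **… WITH THE EULER–POINCARÉ NORMALISATION**: `classOrbitalIntegral m ((ν P)⁻¹ • f) ⟦γ⟧ = Σᶠ_{x ∈ Fix_W(γ)} Θ_{U x}(γ⁻¹)` (the volume cancels; ★ `classOrbitalIntegral_const_smul`
is re-proved in one line by ★ `orbitalIntegral_smul` to keep the imports light). [cite: SchneiderStuhler1997, §III.4] [cite: Kottwitz1988, §2] -/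
theorem classOrbitalIntegral_invMeasure_smul_kType_eq_finsum_levelTrace {Q : G → Prop} (hQ : ∀ g x : G, Q g → Q (x * g * x⁻¹))
    {ν : Measure G} [ν.IsHaarMeasure] [ν.IsMulRightInvariant] {m : OrbitalMeasureFamily G} (hm : m.IsCanonical Q ν)
    {γ : G} (hγ : Q γ) [CompactSpace (Subgroup.centralizer ({γ} : Set G))] (hO : IsClosed {g : G | ∃ y : G, y * γ * y⁻¹ = g})
    {x₀ : W} (hV : ∀ x : W, ∃ g : G, act g x₀ = x) (P : Subgroup G) (hP : ∀ g : G, g ∈ P ↔ act g x₀ = x₀)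
    (hPo : IsOpen (P : Set G)) (hPc : IsCompact (P : Set G))
    (U : W → Subgroup G) (hUo : ∀ x, IsOpen (U x : Set G)) (hUc : ∀ x, IsCompact (U x : Set G))
    (hUg : ∀ (g : G) (x : W), U (act g x) = (U x).map (MulAut.conj g).toMonoidHom) (hUP : U x₀ ≤ P) (hPU : P ≤ Subgroup.normalizer (U x₀ : Set G))
    (τ : Representation ℂ ↥P ↥(ρ.fixedPoints (U x₀))) (hτρ : ∀ (p : ↥P) (w : ↥(ρ.fixedPoints (U x₀))), ((τ p w : ↥(ρ.fixedPoints (U x₀))) : V) = ρ (p : G) (w : V))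
    (hτ : ∀ (u : G) (hu : u ∈ U x₀), τ ⟨u, hUP hu⟩ = 1) [FiniteDimensional ℂ ↥(ρ.fixedPoints (U x₀))]
    {f : G → ℂ} (hfP : ∀ (g : G) (hg : g ∈ P), f g = Representation.character τ ⟨g, hg⟩⁻¹) (hf0 : ∀ g ∉ P, f g = 0) :
    classOrbitalIntegral m (((ν.real (P : Set G))⁻¹ : ℂ) • f) (ConjClasses.mk γ) = ∑ᶠ x ∈ {x : W | act γ x = x}, ρ.levelTrace (hUo x) (hUc x) γ⁻¹ := by
  have hne : (ν.real (P : Set G) : ℂ) ≠ 0 := by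
    rw [Ne, Complex.ofReal_eq_zero]
    exact (measureReal_pos_of_isCompact_isOpen ν hPo hPc).ne'
  rw [classOrbitalIntegral_eq, orbitalIntegral_smul, ← classOrbitalIntegral_eq,
    classOrbitalIntegral_kType_eq_smul_finsum_levelTrace ρ act act_one act_mul hQ hm hγ hO hV P hP hPo hPc U hUo hUc hUg hUP hPU τ hτρ hτ hfP hf0,
    Complex.real_smul, smul_eq_mul, ← mul_assoc, inv_mul_cancel₀ hne, one_mul]

end OneOrbit

/-! ## §2 Additivity of the elliptic class orbital integral over a finite family of test functions -/

/-- **ADDITIVITY (generic (A1))**: for `m` canonical for `(Q, ν)`, `Q γ`, `C_G(γ)` compact and the class of `γ` closed, the class orbital integral of a finite `ℂ`-linear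
combination of continuous compactly supported functions is the linear combination of the class orbital integrals (★ `orbitalIntegral_add_of_isClosed`, ★ `orbitalIntegral_smul`
behind ★ `IsCanonical.classOrbitalIntegral_mk_eq_orbitalIntegral'` at the canonical torus measure of the compact centraliser).  The tree's CM-specific additivity lemmas are not
generalised in place; this is a new declaration. [cite: Rogawski1990, §4.9 p. 54] -/
theorem classOrbitalIntegral_finset_sum_smul_of_isClosed {Q : G → Prop} (hQ : ∀ g x : G, Q g → Q (x * g * x⁻¹))
    {ν : Measure G} [ν.IsHaarMeasure] [ν.IsMulRightInvariant] {m : OrbitalMeasureFamily G} (hm : m.IsCanonical Q ν)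
    {γ : G} (hγ : Q γ) [CompactSpace (Subgroup.centralizer ({γ} : Set G))] (hO : IsClosed {g : G | ∃ y : G, y * γ * y⁻¹ = g})
    {ι : Type*} (s : Finset ι) (c : ι → ℂ) (f : ι → G → ℂ) (hfc : ∀ i ∈ s, Continuous (f i)) (hf : ∀ i ∈ s, HasCompactSupport (f i)) :
    classOrbitalIntegral m (∑ i ∈ s, c i • f i) (ConjClasses.mk γ) = ∑ i ∈ s, c i * classOrbitalIntegral m (f i) (ConjClasses.mk γ) := by
  classical
  haveI : BorelSpace (Subgroup.centralizer ({γ} : Set G)) := Subtype.borelSpace _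
  let K₀ : TopologicalSpace.PositiveCompacts (Subgroup.centralizer ({γ} : Set G)) :=
    ⟨⟨Set.univ, isCompact_univ⟩, by rw [interior_univ]; exact Set.univ_nonempty⟩
  haveI : (haarMeasure K₀).IsInvInvariant := isInvInvariant_of_compactSpace _
  have hcore : haarMeasure K₀ (compactCore (Subgroup.centralizer ({γ} : Set G))) = 1 := by
    rw [compactCore_eq_univ]; exact haarMeasure_self
  haveI : IsClosed ((Subgroup.centralizer ({γ} : Set G) : Subgroup G) : Set G) := isClosed_coe_centralizer_singleton γ
  simp only [hm.classOrbitalIntegral_mk_eq_orbitalIntegral' hQ hγ (haarMeasure K₀) hcore]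
  induction s using Finset.induction_on with
  | empty =>
    simp only [Finset.sum_empty]
    exact orbitalIntegral_zero_fun γ _
  | insert i s hi ih =>
    rw [Finset.sum_insert hi, Finset.sum_insert hi,
      orbitalIntegral_add_of_isClosed γ _ hO ((hfc i (Finset.mem_insert_self i s)).const_smul (c i))
        ((hf i (Finset.mem_insert_self i s)).mono (Function.support_const_smul_subset (c i) (f i)))
        (by rw [Finset.sum_fn]; exact continuous_finsetSum s fun j hj => (hfc j (Finset.mem_insert_of_mem hj)).const_smul (c j))
        (HasCompactSupport.finset_sum fun j hj => (hf j (Finset.mem_insert_of_mem hj)).mono (Function.support_const_smul_subset (c j) (f j))),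
      orbitalIntegral_smul, smul_eq_mul, ih (fun j hj => hfc j (Finset.mem_insert_of_mem hj)) (fun j hj => hf j (Finset.mem_insert_of_mem hj))]

/-! ## §3 The Euler–Poincaré sum over a finite family of facet orbits -/

/-- **THE ELLIPTIC ORBITAL INTEGRAL OF AN EULER–POINCARÉ SUM OF `K`-TYPE FUNCTIONS, UNFOLDED ORBIT BY ORBIT (generic (SS-O) head)**: a finite family, indexed by `i ∈ s`, of
transitive `G`-sets `W i` (the facet orbits) with base points `x₀ i`, compact open stabilisers `P i`, level families `U i` (compact open, transported by conjugation,
`U i (x₀ i) ≤ P i ≤ N(U i (x₀ i))`), `τ i = ρ|_{P i}` on `V^{U i (x₀ i)}` (trivial on `U i (x₀ i)`), `f i = 𝟙_{P i} · χ_{τ i}(·⁻¹)` and signs `(−1)^{d i}` (`d i` = the facet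
dimension); `m` canonical for `(Q, ν)`, `Q γ`, `C_G(γ)` compact, the class of `γ` closed.  Then
`classOrbitalIntegral m (Σ_{i ∈ s} (−1)^{d i} (ν(P i))⁻¹ f i) ⟦γ⟧ = Σ_{i ∈ s} (−1)^{d i} Σᶠ_{x ∈ Fix_{W i}(γ)} Θ_{U i x}(γ⁻¹)` — §2 then §1 orbit by orbit.
[cite: SchneiderStuhler1997, §III.4] [cite: Kottwitz1988, §2] [cite: Rogawski1990, §4.9 p. 54] -/
theorem classOrbitalIntegral_epSum_kType_eq_sum_finsum_levelTrace {Q : G → Prop} (hQ : ∀ g x : G, Q g → Q (x * g * x⁻¹))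
    {ν : Measure G} [ν.IsHaarMeasure] [ν.IsMulRightInvariant] {m : OrbitalMeasureFamily G} (hm : m.IsCanonical Q ν)
    {γ : G} (hγ : Q γ) [CompactSpace (Subgroup.centralizer ({γ} : Set G))] (hO : IsClosed {g : G | ∃ y : G, y * γ * y⁻¹ = g})
    {ι : Type*} (s : Finset ι) {W : ι → Type*} (act : ∀ i, G → W i → W i) (act_one : ∀ (i) (x : W i), act i 1 x = x)
    (act_mul : ∀ (i) (g h : G) (x : W i), act i (g * h) x = act i g (act i h x))
    (x₀ : ∀ i, W i) (hV : ∀ (i) (x : W i), ∃ g : G, act i g (x₀ i) = x) (P : ι → Subgroup G) (hP : ∀ (i) (g : G), g ∈ P i ↔ act i g (x₀ i) = x₀ i)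
    (hPo : ∀ i, IsOpen (P i : Set G)) (hPc : ∀ i, IsCompact (P i : Set G))
    (U : ∀ i, W i → Subgroup G) (hUo : ∀ i x, IsOpen (U i x : Set G)) (hUc : ∀ i x, IsCompact (U i x : Set G))
    (hUg : ∀ (i) (g : G) (x : W i), U i (act i g x) = (U i x).map (MulAut.conj g).toMonoidHom) (hUP : ∀ i, U i (x₀ i) ≤ P i)
    (hPU : ∀ i, P i ≤ Subgroup.normalizer (U i (x₀ i) : Set G))
    (τ : ∀ i, Representation ℂ ↥(P i) ↥(ρ.fixedPoints (U i (x₀ i))))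
    (hτρ : ∀ (i) (p : ↥(P i)) (w : ↥(ρ.fixedPoints (U i (x₀ i)))), ((τ i p w : ↥(ρ.fixedPoints (U i (x₀ i)))) : V) = ρ (p : G) (w : V))
    (hτ : ∀ (i) (u : G) (hu : u ∈ U i (x₀ i)), τ i ⟨u, hUP i hu⟩ = 1) [∀ i, FiniteDimensional ℂ ↥(ρ.fixedPoints (U i (x₀ i)))]
    {f : ι → G → ℂ} (hfP : ∀ (i) (g : G) (hg : g ∈ P i), f i g = Representation.character (τ i) ⟨g, hg⟩⁻¹) (hf0 : ∀ i, ∀ g ∉ P i, f i g = 0) (d : ι → ℕ) :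
    classOrbitalIntegral m (∑ i ∈ s, ((-1 : ℂ) ^ d i * ((ν.real (P i : Set G))⁻¹ : ℂ)) • f i) (ConjClasses.mk γ) =
      ∑ i ∈ s, (-1 : ℂ) ^ d i * ∑ᶠ x ∈ {x : W i | act i γ x = x}, ρ.levelTrace (hUo i x) (hUc i x) γ⁻¹ := by
  rw [classOrbitalIntegral_finset_sum_smul_of_isClosed hQ hm hγ hO s _ f
    (fun i _ => Representation.continuous_of_kType (hUo i (x₀ i)) (hUP i) (τ i) (hτ i) (hfP i) (hf0 i))
    (fun i _ => HasCompactSupport.of_support_subset_isCompact (hPc i) (Representation.support_kType_subset (hf0 i)))]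
  refine Finset.sum_congr rfl fun i _ => ?_
  have hne : (ν.real (P i : Set G) : ℂ) ≠ 0 := by
    rw [Ne, Complex.ofReal_eq_zero]
    exact (measureReal_pos_of_isCompact_isOpen ν (hPo i) (hPc i)).ne'
  rw [classOrbitalIntegral_kType_eq_smul_finsum_levelTrace ρ (act i) (act_one i) (act_mul i) hQ hm hγ hO (hV i) (P i) (hP i) (hPo i) (hPc i) (U i) (hUo i) (hUc i)
      (hUg i) (hUP i) (hPU i) (τ i) (hτρ i) (hτ i) (hfP i) (hf0 i), Complex.real_smul, mul_assoc, ← mul_assoc _ (ν.real (P i : Set G) : ℂ),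
    inv_mul_cancel₀ hne, one_mul]

/-! ## §4 The head in `Finset` currency -/

/-- **THE HEAD IN `Finset` CURRENCY**: §3 with every orbit's fixed-point `finsum` rewritten as a filtered `Finset` sum over a finite set `S i ⊇ Fix_{W i}(γ)` (§0 junction).
[cite: SchneiderStuhler1997, §III.4] [cite: Kottwitz1988, §2] -/
theorem classOrbitalIntegral_epSum_kType_eq_sum_sum_filter_levelTrace {Q : G → Prop} (hQ : ∀ g x : G, Q g → Q (x * g * x⁻¹))
    {ν : Measure G} [ν.IsHaarMeasure] [ν.IsMulRightInvariant] {m : OrbitalMeasureFamily G} (hm : m.IsCanonical Q ν)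
    {γ : G} (hγ : Q γ) [CompactSpace (Subgroup.centralizer ({γ} : Set G))] (hO : IsClosed {g : G | ∃ y : G, y * γ * y⁻¹ = g})
    {ι : Type*} (s : Finset ι) {W : ι → Type*} (act : ∀ i, G → W i → W i) (act_one : ∀ (i) (x : W i), act i 1 x = x)
    (act_mul : ∀ (i) (g h : G) (x : W i), act i (g * h) x = act i g (act i h x))
    (x₀ : ∀ i, W i) (hV : ∀ (i) (x : W i), ∃ g : G, act i g (x₀ i) = x) (P : ι → Subgroup G) (hP : ∀ (i) (g : G), g ∈ P i ↔ act i g (x₀ i) = x₀ i)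
    (hPo : ∀ i, IsOpen (P i : Set G)) (hPc : ∀ i, IsCompact (P i : Set G))
    (U : ∀ i, W i → Subgroup G) (hUo : ∀ i x, IsOpen (U i x : Set G)) (hUc : ∀ i x, IsCompact (U i x : Set G))
    (hUg : ∀ (i) (g : G) (x : W i), U i (act i g x) = (U i x).map (MulAut.conj g).toMonoidHom) (hUP : ∀ i, U i (x₀ i) ≤ P i)
    (hPU : ∀ i, P i ≤ Subgroup.normalizer (U i (x₀ i) : Set G))
    (τ : ∀ i, Representation ℂ ↥(P i) ↥(ρ.fixedPoints (U i (x₀ i))))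
    (hτρ : ∀ (i) (p : ↥(P i)) (w : ↥(ρ.fixedPoints (U i (x₀ i)))), ((τ i p w : ↥(ρ.fixedPoints (U i (x₀ i)))) : V) = ρ (p : G) (w : V))
    (hτ : ∀ (i) (u : G) (hu : u ∈ U i (x₀ i)), τ i ⟨u, hUP i hu⟩ = 1) [∀ i, FiniteDimensional ℂ ↥(ρ.fixedPoints (U i (x₀ i)))]
    {f : ι → G → ℂ} (hfP : ∀ (i) (g : G) (hg : g ∈ P i), f i g = Representation.character (τ i) ⟨g, hg⟩⁻¹) (hf0 : ∀ i, ∀ g ∉ P i, f i g = 0) (d : ι → ℕ)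
    (S : ∀ i, Set (W i)) (hS : ∀ i, (S i).Finite) (hFS : ∀ (i) (x : W i), act i γ x = x → x ∈ S i) [∀ i, DecidablePred fun x : W i => act i γ x = x] :
    classOrbitalIntegral m (∑ i ∈ s, ((-1 : ℂ) ^ d i * ((ν.real (P i : Set G))⁻¹ : ℂ)) • f i) (ConjClasses.mk γ) =
      ∑ i ∈ s, (-1 : ℂ) ^ d i * ∑ x ∈ (hS i).toFinset with act i γ x = x, ρ.levelTrace (hUo i x) (hUc i x) γ⁻¹ := by
  rw [classOrbitalIntegral_epSum_kType_eq_sum_finsum_levelTrace ρ hQ hm hγ hO s act act_one act_mul x₀ hV P hP hPo hPc U hUo hUc hUg hUP hPU τ hτρ hτ hfP hf0 d]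
  exact Finset.sum_congr rfl fun i _ => by rw [finsum_mem_setOf_eq_sum_filter_of_subset (fun x : W i => act i γ x = x) (hS i) (hFS i)]

end Literature.NumberTheory.Automorphic

end
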